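import Mathlib.NumberTheory.NumberField.Basic
import Mathlib.RingTheory.Ideal.Norm.AbsNorm
import Mathlib.RingTheory.Ideal.Quotient.Nilpotent
import Mathlib.RingTheory.DedekindDomain.Ideal.Lemmas
import Mathlib.LinearAlgebra.FreeModule.IdealQuotient
import Mathlib.Algebra.Group.Pi.Units
import Mathlib.Analysis.SpecialFunctions.Log.Basic
import HarnessLib

/-!
# Euler's totient of an ideal: `#(S/I)ˣ = N(I) ∏_{P ∣ I} (1 − 1/N(P))`

Topic `NumberTheory/NumberFields`, namespace `Literature.NumberTheory.NumberFields`. Everything here is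
PROVED; no definitions, no named facts.

For a Dedekind domain `S` that is free of finite rank over `ℤ` (e.g. the ring of integers of a number
field, where `Ideal.absNorm I = #(S/I)`), the number `φ(I) = #(S/I)ˣ` of invertible residue classes
modulo a non-zero ideal `I` — the Euler function of the field, Heath-Brown's `φ_K` (*Primes represented
by `x³ + 2y³`*, Acta Math. 186 (2001), Lemma 8.1: "`φ_K` the Euler function over the field `K`") — is
given by Euler's product formula (folklore; e.g. W. Narkiewicz, *Elementary and Analytic Theory of
Algebraic Numbers*, 3rd ed., Ch. 1 §1.4, for `φ(I) = N(I)∏_{𝔭 ∣ I}(1 − N(𝔭)⁻¹)`):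

* `natCard_units_quot_pow` — `#(S/Pⁿ)ˣ = N(P)^{n−1}(N(P) − 1)` for a maximal `P ≠ 0`, `n ≥ 1` (a class
  is a unit iff it is prime to `P`, Mathlib's `Ideal.Quotient.isUnit_mk_pow_iff_notMem`; the reduction
  `S/Pⁿ → S/P` is onto with kernel of order `N(P)^{n−1}`);
* **`natCard_units_quot_eq_prod`** — `#(S/I)ˣ = ∏_{P ∣ I} N(P)^{v_P(I)−1}(N(P) − 1)` (Chinese remainder
  theorem, Mathlib's `IsDedekindDomain.quotientEquivPiFactors`, and units of a product);
* `absNorm_eq_prod_factors` (`N(I) = ∏ N(P)^{v_P(I)}`), **`natCard_units_quot_eq_absNorm_mul_prod`**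
  (`#(S/I)ˣ = N(I)∏_{P ∣ I}(1 − N(P)⁻¹)` over `ℝ`) and `absNorm_div_natCard_units_eq_prod`
  (`N(I)/φ(I) = ∏_{P ∣ I}(1 − N(P)⁻¹)⁻¹`, the Euler factor appearing in the residue
  `γ₀⁻¹N(C)/φ_K(C)` of Heath-Brown's Lemma 8.1, p. 51).

The products run over `(UniqueFactorizationMonoid.factors I).toFinset`, the distinct prime ideal factors.

## Mathlib search

Mathlib has the totient only on `ℕ`/`ZMod` (`Nat.totient`, `ZMod.card_units_eq_totient`,
`Nat.totient_eq_prod_factorization`); for ideals it has the ingredients used here: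
`IsDedekindDomain.quotientEquivPiFactors`, `MulEquiv.piUnits`, `Units.mapEquiv`,
`Ideal.Quotient.isUnit_mk_pow_iff_notMem`, `Ideal.Quotient.factor(_surjective)`,
`QuotientAddGroup.quotientKerEquivOfSurjective`, `AddSubgroup.card_eq_card_quotient_mul_card_addSubgroup`,
`Ideal.absNorm_apply`, `Ideal.finiteQuotientOfFreeOfNeBot`, `Finset.prod_multiset_map_count`
(`lean search 'card.*⧸.*ˣ|totient.*Ideal'`: no prior ideal totient in the tree either).
-/

noncomputable section

open Ideal UniqueFactorizationMonoid

namespace Literature.NumberTheory.NumberFields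

variable {S : Type*} [CommRing S] [IsDedekindDomain S] [Module.Free ℤ S] [Module.Finite ℤ S]

/-- The units of a monoid are as many as its invertible elements. [folklore] -/
theorem natCard_units_eq_natCard_isUnit (M : Type*) [Monoid M] :
    Nat.card Mˣ = Nat.card {x : M // IsUnit x} := by
  have h : Nat.card Mˣ = Nat.card (Set.range (Units.val : Mˣ → M)) :=
    Nat.card_congr (Equiv.ofInjective _ Units.val_injective)
  rw [h]
  rfl

/-- **Units modulo a prime power**: for a maximal ideal `P` of `S` with finite residue rings and
`n ≥ 1`, `#(S/Pⁿ)ˣ · N(P) = N(P)ⁿ(N(P) − 1)·…`, precisely `#(S/Pⁿ)ˣ = N(P)^{n−1}(N(P) − 1)`: a class is a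
unit iff it is not in `P` (`Ideal.Quotient.isUnit_mk_pow_iff_notMem`), and the reduction `S/Pⁿ → S/P`
is onto with fibres of size `N(Pⁿ)/N(P)`. [folklore] -/
theorem natCard_units_quot_pow {P : Ideal S} [hP : P.IsMaximal] (hP0 : P ≠ ⊥) {n : ℕ} (hn : n ≠ 0) :
    Nat.card ((S ⧸ P ^ n)ˣ) = Ideal.absNorm P ^ (n - 1) * (Ideal.absNorm P - 1) := by
  classical
  have hPn0 : P ^ n ≠ ⊥ := pow_ne_zero n hP0
  haveI : Finite (S ⧸ P ^ n) := Ideal.finiteQuotientOfFreeOfNeBot _ hPn0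
  haveI : Finite (S ⧸ P) := Ideal.finiteQuotientOfFreeOfNeBot _ hP0
  letI : Fintype (S ⧸ P ^ n) := Fintype.ofFinite _
  letI : Fintype (S ⧸ P) := Fintype.ofFinite _
  -- the reduction map
  set f : S ⧸ P ^ n →+* S ⧸ P := Ideal.Quotient.factor (Ideal.pow_le_self hn) with hf
  have hfsurj : Function.Surjective f := Ideal.Quotient.factor_surjective _
  -- units are the classes with non-zero reduction
  have hunit : ∀ y : S ⧸ P ^ n, IsUnit y ↔ f y ≠ 0 := by
    intro y
    obtain ⟨x, rfl⟩ := Ideal.Quotient.mk_surjective y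
    rw [Ideal.Quotient.isUnit_mk_pow_iff_notMem P hn, hf, Ideal.Quotient.factor_mk, Ne,
      Ideal.Quotient.eq_zero_iff_mem]
  -- counting: `#(S/Pⁿ) = #{f = 0} + #{f ≠ 0}` and `#{f = 0} · #(S/P) = #(S/Pⁿ)`
  have hcardPn : Fintype.card (S ⧸ P ^ n) = Ideal.absNorm P ^ n := by
    rw [Fintype.card_eq_nat_card, ← Submodule.cardQuot_apply, ← Ideal.absNorm_apply, map_pow]
  have hcardP : Fintype.card (S ⧸ P) = Ideal.absNorm P := by
    rw [Fintype.card_eq_nat_card, ← Submodule.cardQuot_apply, ← Ideal.absNorm_apply]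
  have hker : Fintype.card {y : S ⧸ P ^ n // f y = 0} * Fintype.card (S ⧸ P) =
      Fintype.card (S ⧸ P ^ n) := by
    -- `{f = 0}` is the kernel of the additive group hom `f`
    have h1 : Fintype.card {y : S ⧸ P ^ n // f y = 0} = Nat.card f.toAddMonoidHom.ker := by
      rw [Fintype.card_eq_nat_card]
      exact Nat.card_congr (Equiv.subtypeEquivRight fun y => Iff.rfl)
    have h2 : Nat.card (S ⧸ P) = Nat.card ((S ⧸ P ^ n) ⧸ f.toAddMonoidHom.ker) :=
      Nat.card_congr (QuotientAddGroup.quotientKerEquivOfSurjective f.toAddMonoidHom hfsurj).toEquiv.symm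
    rw [h1, Fintype.card_eq_nat_card (α := S ⧸ P), h2, Fintype.card_eq_nat_card, mul_comm]
    exact (AddSubgroup.card_eq_card_quotient_mul_card_addSubgroup _).symm
  have hsplit : Fintype.card (S ⧸ P ^ n) =
      Fintype.card {y : S ⧸ P ^ n // f y = 0} + Fintype.card {y : S ⧸ P ^ n // ¬f y = 0} := by
    rw [Fintype.card_subtype_compl, Nat.add_sub_cancel' (Fintype.card_subtype_le _)]
  -- the units
  have hunits : Nat.card ((S ⧸ P ^ n)ˣ) = Fintype.card {y : S ⧸ P ^ n // ¬f y = 0} := by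
    rw [natCard_units_eq_natCard_isUnit, ← Fintype.card_eq_nat_card]
    exact Fintype.card_congr (Equiv.subtypeEquivRight fun y => hunit y)
  -- arithmetic
  have hN1 : 1 ≤ Ideal.absNorm P := Nat.pos_of_ne_zero fun h => hP0 (Ideal.absNorm_eq_zero_iff.mp h)
  have hk : Fintype.card {y : S ⧸ P ^ n // f y = 0} = Ideal.absNorm P ^ (n - 1) := by
    have h := hker
    rw [hcardP, hcardPn] at h
    have hpow : Ideal.absNorm P ^ n = Ideal.absNorm P ^ (n - 1) * Ideal.absNorm P := by
      rw [← pow_succ, Nat.sub_add_cancel (Nat.pos_of_ne_zero hn)]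
    rw [hpow] at h
    exact Nat.eq_of_mul_eq_mul_right hN1 h
  rw [hunits]
  have h := hsplit
  rw [hcardPn, hk] at h
  have hpow : Ideal.absNorm P ^ n = Ideal.absNorm P ^ (n - 1) * Ideal.absNorm P := by
    rw [← pow_succ, Nat.sub_add_cancel (Nat.pos_of_ne_zero hn)]
  have hc : Fintype.card {y : S ⧸ P ^ n // ¬f y = 0} = Ideal.absNorm P ^ n - Ideal.absNorm P ^ (n - 1) := by
    omega
  rw [hc, hpow, Nat.mul_sub, mul_one]

omit [Module.Free ℤ S] [Module.Finite ℤ S] in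
/-- A member of `factors I` is a maximal ideal, non-zero, of positive multiplicity. [folklore] -/
theorem isMaximal_of_mem_factors {I P : Ideal S} (hP : P ∈ factors I) : P.IsMaximal ∧ P ≠ ⊥ := by
  have hprime : Prime P := prime_of_factor P hP
  exact ⟨(Ideal.isPrime_of_prime hprime).isMaximal hprime.ne_zero, hprime.ne_zero⟩

/-- **Euler's totient of an ideal, prime-power form**: for a non-zero ideal `I` of `S` (a Dedekind
domain, free of finite rank over `ℤ`, e.g. a ring of integers),
`#(S/I)ˣ = ∏_{P ∣ I} N(P)^{v_P(I) − 1}(N(P) − 1)` (Chinese remainder theorem,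
`IsDedekindDomain.quotientEquivPiFactors`, and the prime-power count `natCard_units_quot_pow`). [folklore] -/
theorem natCard_units_quot_eq_prod {I : Ideal S} (hI : I ≠ ⊥) :
    Nat.card ((S ⧸ I)ˣ) =
      ∏ P ∈ (factors I).toFinset,
        Ideal.absNorm P ^ (Multiset.count P (factors I) - 1) * (Ideal.absNorm P - 1) := by
  classical
  have e := IsDedekindDomain.quotientEquivPiFactors hI
  have h1 : Nat.card ((S ⧸ I)ˣ) =
      Nat.card (∀ P : (factors I).toFinset, (S ⧸ (P : Ideal S) ^ (Multiset.count ↑P (factors I)))ˣ) :=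
    Nat.card_congr ((Units.mapEquiv e.toMulEquiv).trans (MulEquiv.piUnits)).toEquiv
  rw [h1, Nat.card_pi, ← Finset.prod_coe_sort (factors I).toFinset]
  refine Finset.prod_congr rfl fun P _ => ?_
  obtain ⟨hmax, hP0⟩ := isMaximal_of_mem_factors (Multiset.mem_toFinset.mp P.2)
  haveI := hmax
  exact natCard_units_quot_pow hP0 (Multiset.count_ne_zero.mpr (Multiset.mem_toFinset.mp P.2))

omit [Module.Finite ℤ S] in
/-- `N(I) = ∏_{P ∣ I} N(P)^{v_P(I)}` for `I ≠ 0`. [folklore] -/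
theorem absNorm_eq_prod_factors {I : Ideal S} (hI : I ≠ ⊥) :
    Ideal.absNorm I = ∏ P ∈ (factors I).toFinset, Ideal.absNorm P ^ Multiset.count P (factors I) := by
  classical
  have hprod : (factors I).prod = I := associated_iff_eq.mp (factors_prod hI)
  conv_lhs => rw [← hprod, ← Multiset.map_id' (factors I), Finset.prod_multiset_map_count]
  rw [map_prod]
  simp only [map_pow]

/-- **Euler's totient of an ideal**: `#(S/I)ˣ = N(I)∏_{P ∣ I}(1 − 1/N(P))` for `I ≠ 0`, as real numbers.
[folklore] -/
theorem natCard_units_quot_eq_absNorm_mul_prod {I : Ideal S} (hI : I ≠ ⊥) :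
    (Nat.card ((S ⧸ I)ˣ) : ℝ) =
      Ideal.absNorm I * ∏ P ∈ (factors I).toFinset, (1 - ((Ideal.absNorm P : ℝ))⁻¹) := by
  classical
  rw [natCard_units_quot_eq_prod hI, absNorm_eq_prod_factors hI, Nat.cast_prod, Nat.cast_prod,
    ← Finset.prod_mul_distrib]
  refine Finset.prod_congr rfl fun P hP => ?_
  obtain ⟨-, hP0⟩ := isMaximal_of_mem_factors (Multiset.mem_toFinset.mp hP)
  have hN1 : 1 ≤ Ideal.absNorm P := Nat.pos_of_ne_zero fun h => hP0 (Ideal.absNorm_eq_zero_iff.mp h)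
  have hN : (0 : ℝ) < Ideal.absNorm P := by exact_mod_cast hN1
  have hc : 1 ≤ Multiset.count P (factors I) := Multiset.count_pos.mpr (Multiset.mem_toFinset.mp hP)
  push_cast [Nat.cast_sub hN1]
  have hpow : (Ideal.absNorm P : ℝ) ^ Multiset.count P (factors I) =
      (Ideal.absNorm P : ℝ) ^ (Multiset.count P (factors I) - 1) * Ideal.absNorm P := by
    rw [← pow_succ, Nat.sub_add_cancel hc]
  rw [hpow]
  field_simp

/-- **`N(I)/φ(I) = ∏_{P ∣ I}(1 − N(P)⁻¹)⁻¹`** (the Euler factor at the primes dividing `I`, as in the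
residue `γ₀⁻¹N(C)/φ_K(C)` of Heath-Brown's Lemma 8.1). [folklore] -/
theorem absNorm_div_natCard_units_eq_prod {I : Ideal S} (hI : I ≠ ⊥) :
    (Ideal.absNorm I : ℝ) / Nat.card ((S ⧸ I)ˣ) =
      ∏ P ∈ (factors I).toFinset, (1 - ((Ideal.absNorm P : ℝ))⁻¹)⁻¹ := by
  classical
  rw [natCard_units_quot_eq_absNorm_mul_prod hI, Finset.prod_inv_distrib]
  have hN : (0 : ℝ) < Ideal.absNorm I := by
    exact_mod_cast Nat.pos_of_ne_zero fun h => hI (Ideal.absNorm_eq_zero_iff.mp h)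
  have hprod : (0 : ℝ) < ∏ P ∈ (factors I).toFinset, (1 - ((Ideal.absNorm P : ℝ))⁻¹) := by
    refine Finset.prod_pos fun P hP => ?_
    obtain ⟨hmax, hP0⟩ := isMaximal_of_mem_factors (Multiset.mem_toFinset.mp hP)
    have h2 : (2 : ℝ) ≤ Ideal.absNorm P := by
      have : 1 < Ideal.absNorm P := by
        refine lt_of_le_of_ne (Nat.pos_of_ne_zero fun h => hP0 (Ideal.absNorm_eq_zero_iff.mp h)) ?_
        intro h
        exact hmax.ne_top (Ideal.absNorm_eq_one_iff.mp h.symm)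
      exact_mod_cast this
    have : ((Ideal.absNorm P : ℝ))⁻¹ ≤ 1 / 2 := by
      rw [inv_eq_one_div]; exact one_div_le_one_div_of_le (by norm_num) h2
    linarith
  field_simp

end Literature.NumberTheory.NumberFields

end
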